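import Literature.Geometry.Lorentzian.TeukolskyRadialFlux
import HarnessLib

/-!
# Horizon limits of the normalised scalar horizon solution `R_{𝓗⁺}`:
# `|u_𝓗| → 1` and `|u_𝓗′| → |ω − mω₊|` as `r → r₊⁺` (Teixeira da Costa 2020, Def. 2.3)

Companion of `TeukolskyRadialFlux.lean` (R. Teixeira da Costa, Commun. Math. Phys. 378 (2020)
705–781 = arXiv:1910.02854 [Costa2019]). For spin `s = 0`, a radial function `R` normalised at
`𝓗⁺` as in Def. 2.3 (`Kerr.IsNormalisedHorizonSolution M a 0 ω m R`) satisfies, on a collar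
`(r₊, r₊ + ε)`, `R(r) = f(r)·(r − r₊)^ξ` with `f` smooth on a neighbourhood of `r₊`,
`|f(r₊)|·(r₊² + a²)^{1/2} = 1`, and `ξ = −i (2Mr₊/(r₊ − r₋))(ω − mω₊)` purely imaginary
(`Kerr.horizonExponent_re`), so that `|(r − r₊)^ξ| = 1`. In the variable `u = (r² + a²)^{1/2} R`
with the tortoise derivative `u′ = du/dr* = (Δ/(r² + a²))·du/dr` (`Δ = (r − r₊)(r − r₋)`,
`Kerr.delta_eq_mul`), this gives the two boundary data at `r* = −∞` of the normalised horizon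
solution (DRSR: `u ∼ e^{−i(ω − mω₊) r*}`, `u′ + i(ω − mω₊)u = 0` at `r = r₊`):

* `Costa2019.tendsto_norm_horizonSolution` — `(r² + a²)^{1/2} |R(r)| → 1` as `r → r₊⁺`
  (on the collar `(r² + a²)^{1/2}|R(r)| = (r² + a²)^{1/2}|f(r)| → (r₊² + a²)^{1/2}|f(r₊)| = 1`;
  no restriction on `M`, `a` is needed for this half, so none is assumed);
* `Costa2019.tendsto_norm_deriv_horizonSolution` — for `0 < M`, `|a| < M`:
  `(Δ/(r² + a²))·|d/dr[(r² + a²)^{1/2} R](r)| → |ω − mω₊|` as `r → r₊⁺`. On the collar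
  `(r − r₊)·|(S R)′(r)| = |(r − r₊)(S f)′(r) + S(r) f(r) ξ|` (`S = (r² + a²)^{1/2}`), whence the
  limit is `((r₊ − r₋)/(r₊² + a²))·(r₊² + a²)^{1/2}|f(r₊)|·|ξ| = |ξ|(r₊ − r₋)/(2Mr₊) = |ω − mω₊|`
  by `r₊² + a² = 2Mr₊` (`Kerr.rPlus_sq_add_sq`) and `|ξ| = (2Mr₊/(r₊ − r₋))|ω − mω₊|`
  (`Costa2019.norm_horizonExponent`).

These are the `𝓗⁺` boundary values entering every envelope / energy bound for `u_𝓗`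
(`|u_𝓗|² → 1`, `|u_𝓗′|² → (ω − mω₊)²`); the flux `Δ·Im(R̄ R′) ≡ −(ω − mω₊)` extracted from the
same data is `Costa2019.radialFlux_eq_of_normalisedHorizon`. Not here: the analogous limits at
`r → ∞` for `R_{𝓘⁺}`, the `s ≠ 0` case, the extremal case `|a| = M`. Everything is proved;
theorems only.

## References
* R. Teixeira da Costa, CMP 378 (2020) 705–781 = arXiv:1910.02854: §2.2.1 (`ξ`), Def. 2.3
  (normalised solutions `R_{𝓗⁺}`, `R_{𝓘⁺}`), Proposition 2.20. [Costa2019]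
* M. Dafermos, I. Rodnianski, Y. Shlapentokh-Rothman, *Decay for solutions of the wave equation on
  Kerr exterior spacetimes III*, arXiv:1402.7034: §5.3 (boundary behaviour
  `u′ + i(ω − mω₊)u = 0` at `r₊`). [DafermosRodnianskiShlapentokhrothman2014]
-/

noncomputable section

open Complex Set Filter Topology

namespace Literature.Geometry.Lorentzian.Kerr

namespace Costa2019

/-! ### Collar calculus: `R = f·(r − r₊)^ξ`, `|(r − r₊)^ξ| = 1` -/

/-- Inverting the weight of Def. 2.3 (`s = 0`): `R·t^{0 − ξ} = f` with `t > 0` gives `R = f·t^ξ`.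
[folklore] -/
private theorem eq_mul_cpow_of_mul_cpow_eq {Ry fy ξ : ℂ} {t : ℝ} (ht : 0 < t)
    (h : Ry * ((t : ℝ) : ℂ) ^ (((0 : ℝ) : ℂ) - ξ) = fy) : Ry = fy * ((t : ℝ) : ℂ) ^ ξ := by
  have hT : ((t : ℝ) : ℂ) ≠ 0 := by exact_mod_cast ht.ne'
  have hPne : ((t : ℝ) : ℂ) ^ ξ ≠ 0 := fun h0 => hT (Complex.cpow_eq_zero_iff _ _ |>.1 h0).1
  rw [Complex.ofReal_zero, zero_sub, Complex.cpow_neg] at h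
  rw [← h, mul_assoc, inv_mul_cancel₀ hPne, mul_one]

/-- `|t^ξ| = 1` for real `t > 0` and `Re ξ = 0`. [folklore] -/
private theorem norm_ofReal_cpow_of_re_eq_zero {t : ℝ} (ht : 0 < t) {ξ : ℂ} (hξ : ξ.re = 0) :
    ‖((t : ℝ) : ℂ) ^ ξ‖ = 1 := by
  rw [Complex.norm_cpow_eq_rpow_re_of_pos ht, hξ, Real.rpow_zero]

/-- `d/ds (s² + a²)^{1/2} = s/(s² + a²)^{1/2}` at a point `y` with `y² + a² > 0`. [folklore] -/
private theorem hasDerivAt_sqrt_sq_add_sq {a y : ℝ} (hy : 0 < y ^ 2 + a ^ 2) :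
    HasDerivAt (fun s : ℝ => Real.sqrt (s ^ 2 + a ^ 2)) (y / Real.sqrt (y ^ 2 + a ^ 2)) y := by
  have h1 : HasDerivAt (fun s : ℝ => s ^ 2 + a ^ 2) (2 * y) y := by
    simpa using (hasDerivAt_pow 2 y).add_const (a ^ 2)
  refine (h1.sqrt hy.ne').congr_deriv ?_
  rw [mul_div_mul_left _ _ (two_ne_zero' ℝ)]

/-- **Collar identity for `u′`.** If `R = f·(t − rp)^ξ` near `y > rp` with `Re ξ = 0`, and the
real weight `S` and `f` are differentiable at `y`, then
`(y − rp)·|(S R)′(y)| = |(y − rp)·(S′ f + S f′)(y) + S(y) f(y) ξ|`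
(`(t − rp)^ξ` has modulus one and derivative `(t − rp)^ξ·ξ/(t − rp)`). [folklore] -/
private theorem sub_mul_norm_deriv_of_factor {R f : ℝ → ℂ} {S : ℝ → ℝ} {rp y S' : ℝ} {ξ f' : ℂ}
    (hy : rp < y) (hξ : ξ.re = 0) (hS : HasDerivAt S S' y) (hf : HasDerivAt f f' y)
    (hRf : ∀ᶠ t in 𝓝 y, R t = f t * ((t - rp : ℝ) : ℂ) ^ ξ) :
    (y - rp) * ‖deriv (fun s => ((S s : ℝ) : ℂ) * R s) y‖ =
      ‖((y - rp : ℝ) : ℂ) * (((S' : ℝ) : ℂ) * f y + ((S y : ℝ) : ℂ) * f') +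
        ((S y : ℝ) : ℂ) * f y * ξ‖ := by
  have ht : (0 : ℝ) < y - rp := sub_pos.2 hy
  have hT : ((y - rp : ℝ) : ℂ) ≠ 0 := by exact_mod_cast ht.ne'
  set P : ℂ := ((y - rp : ℝ) : ℂ) ^ ξ with hP
  have hPn : ‖P‖ = 1 := norm_ofReal_cpow_of_re_eq_zero ht hξ
  have hev : (fun s => ((S s : ℝ) : ℂ) * R s) =ᶠ[𝓝 y]
      fun s => ((S s : ℝ) : ℂ) * f s * ((s - rp : ℝ) : ℂ) ^ ξ := by
    filter_upwards [hRf] with t ht'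
    rw [ht', mul_assoc]
  have hD : HasDerivAt (fun s => ((S s : ℝ) : ℂ) * R s)
      ((((S' : ℝ) : ℂ) * f y + ((S y : ℝ) : ℂ) * f') * P +
        ((S y : ℝ) : ℂ) * f y * (P * (ξ / ((y - rp : ℝ) : ℂ)))) y :=
    ((hS.ofReal_comp.mul hf).mul (hasDerivAt_ofReal_sub_cpow rp ξ hy)).congr_of_eventuallyEq hev
  have key : ((y - rp : ℝ) : ℂ) * deriv (fun s => ((S s : ℝ) : ℂ) * R s) y =
      P * (((y - rp : ℝ) : ℂ) * (((S' : ℝ) : ℂ) * f y + ((S y : ℝ) : ℂ) * f') +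
        ((S y : ℝ) : ℂ) * f y * ξ) := by
    rw [hD.deriv]
    linear_combination ((S y : ℝ) : ℂ) * f y * P * ξ * mul_inv_cancel₀ hT
  have hn := congrArg (fun z : ℂ => ‖z‖) key
  simp only [norm_mul, hPn, one_mul, Complex.norm_real, Real.norm_eq_abs, abs_of_pos ht] at hn
  exact hn

/-! ### `|u_𝓗| → 1` -/

/-- **`(r² + a²)^{1/2}|R_{𝓗⁺}(r)| → 1` as `r → r₊⁺`** for a radial function normalised at `𝓗⁺`
as in Def. 2.3 (`s = 0`): on the collar `|R| = |f|` (`|(r − r₊)^ξ| = 1`, `Re ξ = 0`), `f` is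
continuous at `r₊`, and `(r₊² + a²)^{1/2}|f(r₊)| = 1` by the normalisation. No hypothesis on
`M`, `a` is needed. [cite: Costa2019, Definition 2.3] -/
theorem tendsto_norm_horizonSolution {M a ω m : ℝ} {R : ℝ → ℂ}
    (hn : IsNormalisedHorizonSolution M a 0 ω m R) :
    Tendsto (fun r ↦ Real.sqrt (r ^ 2 + a ^ 2) * ‖R r‖) (𝓝[>] (rPlus M a)) (𝓝 1) := by
  obtain ⟨ε, hε, f, hf, hRf, hnorm⟩ := hn
  have hξre : (horizonExponent M a ω m).re = 0 := horizonExponent_re M a ω m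
  have hI0 : Ioo (rPlus M a - ε) (rPlus M a + ε) ∈ 𝓝 (rPlus M a) :=
    Ioo_mem_nhds (by linarith) (by linarith)
  have hfc : ContinuousAt f (rPlus M a) := hf.continuousOn.continuousAt hI0
  have hc : ContinuousAt (fun y : ℝ => Real.sqrt (y ^ 2 + a ^ 2) * ‖f y‖) (rPlus M a) := by
    fun_prop
  have h1 : Real.sqrt (rPlus M a ^ 2 + a ^ 2) * ‖f (rPlus M a)‖ = 1 := by
    rw [Real.rpow_zero, mul_one, mul_comm] at hnorm
    exact hnorm
  have h2 : Tendsto (fun y : ℝ => Real.sqrt (y ^ 2 + a ^ 2) * ‖f y‖) (𝓝[>] rPlus M a)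
      (𝓝 (Real.sqrt (rPlus M a ^ 2 + a ^ 2) * ‖f (rPlus M a)‖)) :=
    hc.tendsto.mono_left nhdsWithin_le_nhds
  rw [h1] at h2
  refine h2.congr' ?_
  filter_upwards [Ioo_mem_nhdsGT (show rPlus M a < rPlus M a + ε by linarith)] with y hy
  rw [eq_mul_cpow_of_mul_cpow_eq (sub_pos.2 hy.1) (hRf y hy), norm_mul,
    norm_ofReal_cpow_of_re_eq_zero (sub_pos.2 hy.1) hξre, mul_one]

/-! ### `|u_𝓗′| → |ω − mω₊|` -/

/-- `|ξ| = (2Mr₊/(r₊ − r₋))·|ω − mω₊|` for `0 < M`, `|a| < M` (the prefactor is positive: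
`r₊ > 0`, `r₊ > r₋`). [cite: Costa2019, §2.2.1] -/
theorem norm_horizonExponent {M a : ℝ} (hM : 0 < M) (ha : |a| < M) (ω m : ℝ) :
    ‖horizonExponent M a ω m‖ =
      2 * M * rPlus M a / (rPlus M a - rMinus M a) * |ω - m * horizonAngularVelocity M a| := by
  have hd : 0 < rPlus M a - rMinus M a :=
    sub_pos.2 (IsSubextremal.rMinus_lt_rPlus (show IsSubextremal M a from ha))
  have hr : 0 < rPlus M a := rPlus_pos hM a
  have hc : 0 < 2 * M * rPlus M a / (rPlus M a - rMinus M a) := by positivity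
  rw [horizonExponent, norm_mul, norm_neg, Complex.norm_I, one_mul, Complex.norm_real,
    Real.norm_eq_abs, abs_mul, abs_of_pos hc]

/-- **`(Δ/(r² + a²))·|d/dr[(r² + a²)^{1/2} R_{𝓗⁺}](r)| → |ω − mω₊|` as `r → r₊⁺`** (`s = 0`,
`0 < M`, `|a| < M`), i.e. `|u_𝓗′| → |ω − mω₊|` at `r* = −∞` for `u = (r² + a²)^{1/2} R`,
`′ = d/dr* = (Δ/(r² + a²)) d/dr`, `R` normalised at `𝓗⁺` as in Def. 2.3: on the collar
`(r − r₊)|(S R)′| = |(r − r₊)(S f)′ + S f ξ|` (`S = (r² + a²)^{1/2}`, `|(r − r₊)^ξ| = 1`), and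
`Δ/(r² + a²) = (r − r₊)(r − r₋)/(r² + a²)`, so the limit is
`((r₊ − r₋)/(r₊² + a²))·(r₊² + a²)^{1/2}|f(r₊)|·|ξ| = |ξ|(r₊ − r₋)/(2Mr₊) = |ω − mω₊|`.
[cite: Costa2019, Definition 2.3] -/
theorem tendsto_norm_deriv_horizonSolution {M a ω m : ℝ} (hM : 0 < M) (ha : |a| < M)
    {R : ℝ → ℂ} (hn : IsNormalisedHorizonSolution M a 0 ω m R) :
    Tendsto (fun r ↦ delta M a r / (r ^ 2 + a ^ 2) *
        ‖deriv (fun s : ℝ ↦ ((Real.sqrt (s ^ 2 + a ^ 2) : ℝ) : ℂ) * R s) r‖)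
      (𝓝[>] (rPlus M a)) (𝓝 |ω - m * horizonAngularVelocity M a|) := by
  obtain ⟨ε, hε, f, hf, hRf, hnorm⟩ := hn
  set ξ : ℂ := horizonExponent M a ω m with hξ
  have hξre : ξ.re = 0 := horizonExponent_re M a ω m
  have htop : ((⊤ : ℕ∞) : WithTop ℕ∞) ≠ 0 := by simp
  have hrp : 0 < rPlus M a := rPlus_pos hM a
  have hra : 0 < rPlus M a ^ 2 + a ^ 2 := by positivity
  have hI0 : Ioo (rPlus M a - ε) (rPlus M a + ε) ∈ 𝓝 (rPlus M a) :=
    Ioo_mem_nhds (by linarith) (by linarith)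
  have hfc : ContinuousAt f (rPlus M a) := hf.continuousOn.continuousAt hI0
  have hf'c : ContinuousAt (deriv f) (rPlus M a) :=
    (hf.continuousOn_deriv_of_isOpen isOpen_Ioo (by simp)).continuousAt hI0
  set f' : ℝ → ℂ := deriv f with hf'
  -- the comparison function `G = ((y − r₋)/(y² + a²))·|(y − r₊)(S f)′(y) + S(y) f(y) ξ|`
  set G : ℝ → ℝ := fun y => (y - rMinus M a) / (y ^ 2 + a ^ 2) *
      ‖((y - rPlus M a : ℝ) : ℂ) * ((((y / Real.sqrt (y ^ 2 + a ^ 2) : ℝ)) : ℂ) * f y +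
          ((Real.sqrt (y ^ 2 + a ^ 2) : ℝ) : ℂ) * f' y) +
        ((Real.sqrt (y ^ 2 + a ^ 2) : ℝ) : ℂ) * f y * ξ‖ with hG
  -- `G` is continuous at `r₊` …
  have hGc : ContinuousAt G (rPlus M a) := by
    have hS0 : Real.sqrt (rPlus M a ^ 2 + a ^ 2) ≠ 0 := (Real.sqrt_pos.2 hra).ne'
    have hra' : rPlus M a ^ 2 + a ^ 2 ≠ 0 := hra.ne'
    rw [hG]
    fun_prop (disch := assumption)
  -- … with value `|ω − mω₊|` there
  have hGv : G (rPlus M a) = |ω - m * horizonAngularVelocity M a| := by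
    have h1 : Real.sqrt (rPlus M a ^ 2 + a ^ 2) * ‖f (rPlus M a)‖ = 1 := by
      rw [Real.rpow_zero, mul_one, mul_comm] at hnorm
      exact hnorm
    have hd : rPlus M a - rMinus M a ≠ 0 :=
      (sub_pos.2 (IsSubextremal.rMinus_lt_rPlus (show IsSubextremal M a from ha))).ne'
    have h2 : 2 * M * rPlus M a ≠ 0 := by positivity
    rw [hG]
    simp only [sub_self, Complex.ofReal_zero, zero_mul, zero_add, norm_mul, Complex.norm_real,
      Real.norm_eq_abs, abs_of_nonneg (Real.sqrt_nonneg _)]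
    rw [h1, one_mul, hξ, norm_horizonExponent hM ha, rPlus_sq_add_sq ha.le]
    field_simp
  have hlim : Tendsto G (𝓝[>] rPlus M a) (𝓝 |ω - m * horizonAngularVelocity M a|) := by
    rw [← hGv]
    exact hGc.tendsto.mono_left nhdsWithin_le_nhds
  -- on the collar the target function IS `G`
  refine hlim.congr' ?_
  filter_upwards [Ioo_mem_nhdsGT (show rPlus M a < rPlus M a + ε by linarith)] with y hy
  have hy0 : 0 < y ^ 2 + a ^ 2 := by
    have := hrp.trans hy.1
    positivity
  have hyI : Ioo (rPlus M a - ε) (rPlus M a + ε) ∈ 𝓝 y := Ioo_mem_nhds (by linarith [hy.1]) hy.2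
  have hfy : HasDerivAt f (f' y) y :=
    ((hf.differentiableOn htop y ⟨by linarith [hy.1], hy.2⟩).differentiableAt hyI).hasDerivAt
  have hev : ∀ᶠ t in 𝓝 y, R t = f t * ((t - rPlus M a : ℝ) : ℂ) ^ ξ := by
    filter_upwards [Ioo_mem_nhds hy.1 hy.2] with t ht using
      eq_mul_cpow_of_mul_cpow_eq (sub_pos.2 ht.1) (hRf t ht)
  have key := sub_mul_norm_deriv_of_factor hy.1 hξre (hasDerivAt_sqrt_sq_add_sq hy0) hfy hev
  rw [hG]
  dsimp only
  rw [delta_eq_mul ha.le, ← key]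
  ring

/-! ### The Sonin–Pólya energy datum `(ω² − V)|u_𝓗|² + |u_𝓗′|² → 2(ω − mω₊)²` -/

/-- **The horizon value of the Sonin–Pólya energy of `u_𝓗`** (`s = 0`, `0 < M`, `|a| < M`): for
`R` normalised at `𝓗⁺` as in Def. 2.3, `u = (r² + a²)^{1/2} R`, `u′ = (Δ/(r² + a²)) du/dr` and
Carter's potential `V = Kerr.sepPotential M a ω m Λ` (any `Λ`),
`(ω² − V(r))|u(r)|² + |u′(r)|² → 2(ω − mω₊)²` as `r → r₊⁺`, by `|u| → 1`, `|u′| → |ω − mω₊|`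
and `ω² − V(r₊) = (ω − mω₊)²` (`Kerr.omega_sq_sub_sepPotential_rPlus`; `V` is continuous at
`r₊ > 0`). [cite: Costa2019, Definition 2.3] -/
theorem tendsto_soninEnergy_horizonSolution {M a ω : ℝ} {m : ℤ} (Λ : ℝ) (hM : 0 < M)
    (ha : |a| < M) {R : ℝ → ℂ} (hn : IsNormalisedHorizonSolution M a 0 ω m R) :
    Tendsto (fun r ↦ (ω ^ 2 - sepPotential M a ω m Λ r) * (Real.sqrt (r ^ 2 + a ^ 2) * ‖R r‖) ^ 2 +
        (delta M a r / (r ^ 2 + a ^ 2) *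
          ‖deriv (fun s : ℝ ↦ ((Real.sqrt (s ^ 2 + a ^ 2) : ℝ) : ℂ) * R s) r‖) ^ 2)
      (𝓝[>] (rPlus M a)) (𝓝 (2 * (ω - m * horizonAngularVelocity M a) ^ 2)) := by
  have hrp : 0 < rPlus M a := rPlus_pos hM a
  have hVc : ContinuousAt (fun r => ω ^ 2 - sepPotential M a ω m Λ r) (rPlus M a) := by
    have h2 : (rPlus M a ^ 2 + a ^ 2) ^ 2 ≠ 0 := by positivity
    have h3 : (rPlus M a ^ 2 + a ^ 2) ^ 3 ≠ 0 := by positivity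
    have h4 : (rPlus M a ^ 2 + a ^ 2) ^ 4 ≠ 0 := by positivity
    unfold sepPotential sepPotential₀ sepPotential₁ delta
    fun_prop (disch := assumption)
  have hVv : ω ^ 2 - sepPotential M a ω m Λ (rPlus M a) =
      (ω - m * horizonAngularVelocity M a) ^ 2 := by
    have h0 : 2 * M * rPlus M a ≠ 0 := by positivity
    rw [omega_sq_sub_sepPotential_rPlus ha.le hM, horizonAngularVelocity]
    field_simp
    ring
  have hV : Tendsto (fun r => ω ^ 2 - sepPotential M a ω m Λ r) (𝓝[>] rPlus M a)
      (𝓝 ((ω - m * horizonAngularVelocity M a) ^ 2)) := by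
    rw [← hVv]
    exact hVc.tendsto.mono_left nhdsWithin_le_nhds
  have h := (hV.mul ((tendsto_norm_horizonSolution hn).pow 2)).add
    ((tendsto_norm_deriv_horizonSolution hM ha hn).pow 2)
  rw [one_pow, mul_one, sq_abs, ← two_mul] at h
  exact h

end Costa2019

end Literature.Geometry.Lorentzian.Kerr

end
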